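import Mathlib
import HarnessLib
import HarnessLib.Audit
import Summits.ValiantsHypothesis.ValiantsHypothesis.Theorems.LacunarySymmetroidMatrixDescartesMultiplierQuotient
import Summits.ValiantsHypothesis.ValiantsHypothesis.Theorems.LacunarySymmetroidMatrixDescartesTopBinomial
import Summits.ValiantsHypothesis.ValiantsHypothesis.Theorems.LacunarySymmetroidMatrixDescartesZeroOnceLocal

/-!
# ValiantsHypothesis / LacunarySymmetroid — crux `MatrixDescartes` (stmt-ValiantsHypothesis-18050, V1), LINE (A) «product_plus_one»:
# RATE-FUNCTION FACTS FOR IDENTICAL ROWS, packaged (kit for THEOREM C `IdenticalRowsAtMostThree`; same computation as ✓ `identicalRowsAtMostFour`)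

For one W row `(−α,κ,γ)` times `P^k` (`P = p₀ + q₀X^a + s₀X^c`): the rate function `J` of ✓ `…MultiplierQuotient`, its derivative `J′`, and the
threshold `T = (a+c−3A) − (2k+1)e` (`e` = row rate, `A = θ²g/θg`): `T` is strictly decreasing and at a zero of `J` the sign of `J′` is the sign
of `T` (`t·ψ_B·θJ = k(k+1)e²T`, the K-identity of ✓ `…SmallRatio` specialised), plus the engine's Rolle fact — as one existence statement
`exists_rateFacts_identical` for files that need these facts without re-deriving them.
HONEST FRAMING: kit/helper; closes no stub; `OneChangeFloorK3`, `MatrixDescartes` OPEN; `VP ≠ VNP` is NOT proved.  No definitions, no named facts, no sorry.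
-/


set_option linter.dupNamespace false

namespace Summit.ValiantsHypothesis.ValiantsHypothesis.Theorems.LacunarySymmetroidMatrixDescartes

namespace ZeroChange

open Polynomial Finset Set Filter Topology

/-- ★ **RATE-FUNCTION FACTS FOR IDENTICAL ROWS, PACKAGED** (kit for THEOREM C): for one W row `(−α,κ,γ)` and the block `P^k`
(`P = p₀ + q₀X^a + s₀X^c`, `p₀, s₀ > 0 ≤ q₀`, `k ≥ 1`) there are `J` (the engine's rate function), `J′` and a STRICTLY DECREASING threshold
`T` with: `J′` is the derivative of `J` on `(0,∞)`; at a zero of `J`, `T > 0 ⇒ J′ > 0` and `T < 0 ⇒ J′ < 0`; between two positive critical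
points `J` vanishes; and `J` is the explicit rate function of ✓ `exists_rateJ_zero_between_crit` / ✓ `exists_multiplierQuotient`. -/
theorem exists_rateFacts_identical (k a c : ℕ) (ha : 0 < a) (hac : a < c) (α κ γ p₀ q₀ s₀ : ℝ)
    (hκ : 0 ≤ κ) (hγ : 0 < γ) (hp₀ : 0 < p₀) (hq₀ : 0 ≤ q₀) (hs₀ : 0 < s₀) (hk : 0 < k) :
    ∃ J J' T : ℝ → ℝ,
      (∀ t, 0 < t → HasDerivAt J (J' t) t) ∧
      (∀ t t', 0 < t → t < t' → T t' < T t) ∧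
      (∀ t, 0 < t → J t = 0 → 0 < T t → 0 < J' t) ∧
      (∀ t, 0 < t → J t = 0 → T t < 0 → J' t < 0) ∧
      (∀ u v, 0 < u → u < v →
        (derivative (row a c (-α) κ γ * ∏ i : Fin k, row a c ((fun _ => p₀) i) ((fun _ => q₀) i) ((fun _ => s₀) i))).eval u = 0 →
        (derivative (row a c (-α) κ γ * ∏ i : Fin k, row a c ((fun _ => p₀) i) ((fun _ => q₀) i) ((fun _ => s₀) i))).eval v = 0 →
        ∃ ξ, u < ξ ∧ ξ < v ∧ J ξ = 0) ∧
      (∀ t, J t =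
        (∑ i : Fin k, (((a : ℝ) ^ 2 * (fun _ => q₀) i * t ^ a + (c : ℝ) ^ 2 * (fun _ => s₀) i * t ^ c) /
              ((fun _ => p₀) i + (fun _ => q₀) i * t ^ a + (fun _ => s₀) i * t ^ c)
            - (((a : ℝ) * (fun _ => q₀) i * t ^ a + (c : ℝ) * (fun _ => s₀) i * t ^ c) /
              ((fun _ => p₀) i + (fun _ => q₀) i * t ^ a + (fun _ => s₀) i * t ^ c)) ^ 2)) /
          (∑ i : Fin k, ((a : ℝ) * (fun _ => q₀) i * t ^ a + (c : ℝ) * (fun _ => s₀) i * t ^ c) /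
              ((fun _ => p₀) i + (fun _ => q₀) i * t ^ a + (fun _ => s₀) i * t ^ c))
        - (∑ i : Fin k, ((a : ℝ) * (fun _ => q₀) i * t ^ a + (c : ℝ) * (fun _ => s₀) i * t ^ c) /
              ((fun _ => p₀) i + (fun _ => q₀) i * t ^ a + (fun _ => s₀) i * t ^ c))
        - ((a : ℝ) ^ 2 * κ * t ^ a + (c : ℝ) ^ 2 * γ * t ^ c) / ((a : ℝ) * κ * t ^ a + (c : ℝ) * γ * t ^ c)) := by
  classical
  have hc : 0 < c := ha.trans hac
  have ha' : (0 : ℝ) < a := by exact_mod_cast ha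
  have hc' : (0 : ℝ) < c := by exact_mod_cast hc
  have hac' : (a : ℝ) < c := by exact_mod_cast hac
  set p : Fin k → ℝ := fun _ => p₀ with hpdef
  set q : Fin k → ℝ := fun _ => q₀ with hqdef
  set s : Fin k → ℝ := fun _ => s₀ with hsdef
  have hp : ∀ i, p i = p₀ := fun _ => rfl
  have hq : ∀ i, q i = q₀ := fun _ => rfl
  have hs : ∀ i, s i = s₀ := fun _ => rfl
  have h : ∀ i, 0 < p i ∧ 0 ≤ q i ∧ 0 ≤ s i := fun i => ⟨hp₀, hq₀, hs₀.le⟩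
  have h' : ∀ i, 0 ≤ p i ∧ 0 ≤ q i ∧ 0 ≤ s i ∧ 0 < p i + q i + s i :=
    fun i => ⟨(h i).1.le, (h i).2.1, (h i).2.2, by linarith [(h i).1, (h i).2.1, (h i).2.2]⟩
  have j₀ : Fin k := ⟨0, hk⟩
  -- the real functions
  obtain ⟨P, hP⟩ : ∃ P : Fin k → ℝ → ℝ, ∀ i t, P i t = p i + q i * t ^ a + s i * t ^ c := ⟨_, fun _ _ => rfl⟩
  obtain ⟨N, hN⟩ : ∃ N : Fin k → ℝ → ℝ, ∀ i t, N i t = (a : ℝ) * q i * t ^ a + (c : ℝ) * s i * t ^ c :=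
    ⟨_, fun _ _ => rfl⟩
  obtain ⟨M, hM⟩ : ∃ M : Fin k → ℝ → ℝ, ∀ i t, M i t = (a : ℝ) ^ 2 * q i * t ^ a + (c : ℝ) ^ 2 * s i * t ^ c :=
    ⟨_, fun _ _ => rfl⟩
  obtain ⟨L, hL⟩ : ∃ L : Fin k → ℝ → ℝ, ∀ i t, L i t = (a : ℝ) ^ 3 * q i * t ^ a + (c : ℝ) ^ 3 * s i * t ^ c :=
    ⟨_, fun _ _ => rfl⟩
  obtain ⟨ψ, hψ⟩ : ∃ ψ : Fin k → ℝ → ℝ, ∀ i t, ψ i t = N i t / P i t := ⟨_, fun _ _ => rfl⟩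
  obtain ⟨ψB, hψB⟩ : ∃ ψB : ℝ → ℝ, ∀ t, ψB t = ∑ i, ψ i t := ⟨_, fun _ => rfl⟩
  obtain ⟨V, hV⟩ : ∃ V : ℝ → ℝ, ∀ t, V t = ∑ i, (M i t / P i t - ψ i t ^ 2) := ⟨_, fun _ => rfl⟩
  obtain ⟨V₃, hV₃⟩ : ∃ V₃ : ℝ → ℝ, ∀ t, V₃ t = ∑ i, (L i t / P i t - M i t * N i t / P i t ^ 2
      - 2 * (N i t / P i t) * (M i t / P i t - (N i t / P i t) ^ 2)) := ⟨_, fun _ => rfl⟩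
  obtain ⟨G, hG⟩ : ∃ G : ℝ → ℝ, ∀ t, G t = (a : ℝ) * κ * t ^ a + (c : ℝ) * γ * t ^ c := ⟨_, fun _ => rfl⟩
  obtain ⟨G₂, hG₂⟩ : ∃ G₂ : ℝ → ℝ, ∀ t, G₂ t = (a : ℝ) ^ 2 * κ * t ^ a + (c : ℝ) ^ 2 * γ * t ^ c :=
    ⟨_, fun _ => rfl⟩
  obtain ⟨G₃, hG₃⟩ : ∃ G₃ : ℝ → ℝ, ∀ t, G₃ t = (a : ℝ) ^ 3 * κ * t ^ a + (c : ℝ) ^ 3 * γ * t ^ c :=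
    ⟨_, fun _ => rfl⟩
  obtain ⟨J, hJ⟩ : ∃ J : ℝ → ℝ, ∀ t, J t = V t / ψB t - ψB t - G₂ t / G t := ⟨_, fun _ => rfl⟩
  obtain ⟨J', hJ'⟩ : ∃ J' : ℝ → ℝ, ∀ t, J' t = ((V₃ t * ψB t - V t * V t) / ψB t ^ 2 - V t
      - (G₃ t * G t - G₂ t * G₂ t) / G t ^ 2) / t := ⟨_, fun _ => rfl⟩
  have hJfun : ∀ t, J t =
      (∑ i, (((a : ℝ) ^ 2 * q i * t ^ a + (c : ℝ) ^ 2 * s i * t ^ c) / (p i + q i * t ^ a + s i * t ^ c)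
          - (((a : ℝ) * q i * t ^ a + (c : ℝ) * s i * t ^ c) / (p i + q i * t ^ a + s i * t ^ c)) ^ 2)) /
        (∑ i, ((a : ℝ) * q i * t ^ a + (c : ℝ) * s i * t ^ c) / (p i + q i * t ^ a + s i * t ^ c))
      - (∑ i, ((a : ℝ) * q i * t ^ a + (c : ℝ) * s i * t ^ c) / (p i + q i * t ^ a + s i * t ^ c))
      - ((a : ℝ) ^ 2 * κ * t ^ a + (c : ℝ) ^ 2 * γ * t ^ c) / ((a : ℝ) * κ * t ^ a + (c : ℝ) * γ * t ^ c) := by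
    intro t
    rw [hJ, hV, hψB, hG₂, hG]
    simp only [hψ, hM, hN, hP]
  -- elementary facts
  have hPpos : ∀ i t, 0 < t → 0 < P i t := fun i t ht => by
    rw [hP]
    have := (h i).1
    have : 0 ≤ q i * t ^ a := mul_nonneg (h i).2.1 (pow_pos ht a).le
    have : 0 ≤ s i * t ^ c := mul_nonneg (h i).2.2 (pow_pos ht c).le
    linarith
  have hGpos : ∀ t, 0 < t → 0 < G t := fun t ht => by
    rw [hG]; exact add_pos_of_nonneg_of_pos (by positivity) (by positivity)
  have hNnn : ∀ i t, 0 < t → 0 ≤ N i t := fun i t ht => by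
    rw [hN]
    exact add_nonneg (mul_nonneg (mul_nonneg ha'.le (h i).2.1) (pow_pos ht a).le)
      (mul_nonneg (mul_nonneg hc'.le (h i).2.2) (pow_pos ht c).le)
  have hψnn : ∀ i t, 0 < t → 0 ≤ ψ i t := fun i t ht => by
    rw [hψ]; exact div_nonneg (hNnn i t ht) (hPpos i t ht).le
  have hψBnn : ∀ t, 0 < t → 0 ≤ ψB t := fun t ht => by
    rw [hψB]; exact sum_nonneg fun i _ => hψnn i t ht
  have hAgt : ∀ t, 0 < t → (a : ℝ) < G₂ t / G t := fun t ht => by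
    rw [lt_div_iff₀ (hGpos t ht), hG₂, hG]
    have : 0 < (c : ℝ) * γ * t ^ c * ((c : ℝ) - a) := by
      have := sub_pos.2 hac'
      positivity
    nlinarith [mul_nonneg (mul_nonneg ha'.le hκ) (pow_pos ht a).le]
  -- `ψ_B > 0` everywhere (the rows have a top letter `s₀ > 0`)
  have hψBpos : ∀ t, 0 < t → 0 < ψB t := by
    intro t ht
    have hNi : 0 < N j₀ t := by
      rw [hN, hs j₀]
      exact add_pos_of_nonneg_of_pos (mul_nonneg (mul_nonneg ha'.le (h j₀).2.1) (pow_pos ht a).le) (by positivity)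
    have hψi : 0 < ψ j₀ t := by rw [hψ]; exact div_pos hNi (hPpos j₀ t ht)
    rw [hψB]
    exact lt_of_lt_of_le hψi (single_le_sum (f := fun j => ψ j t) (fun j _ => hψnn j t ht) (mem_univ j₀))
  -- the derivative of `J` on `(0,∞)`
  have hJd : ∀ t, 0 < t → HasDerivAt J (J' t) t := by
    intro t ht
    have ht0 : t ≠ 0 := ht.ne'
    have hpowa : (a : ℝ) * t ^ (a - 1) = (a : ℝ) * t ^ a / t := by
      rw [eq_div_iff ht0, mul_assoc, ← pow_succ, Nat.sub_add_cancel (show 1 ≤ a from ha)]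
    have hpowc : (c : ℝ) * t ^ (c - 1) = (c : ℝ) * t ^ c / t := by
      rw [eq_div_iff ht0, mul_assoc, ← pow_succ, Nat.sub_add_cancel (show 1 ≤ c from hc)]
    have hrow : ∀ u v w : ℝ, HasDerivAt (fun x => u + v * x ^ a + w * x ^ c)
        (((a : ℝ) * v * t ^ a + (c : ℝ) * w * t ^ c) / t) t := by
      intro u v w
      refine ((((hasDerivAt_pow a t).const_mul v).const_add u).fun_add
        ((hasDerivAt_pow c t).const_mul w)).congr_deriv ?_
      have e1 : v * ((a : ℝ) * t ^ (a - 1)) = (a : ℝ) * v * t ^ a / t := by rw [hpowa]; ring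
      have e2 : w * ((c : ℝ) * t ^ (c - 1)) = (c : ℝ) * w * t ^ c / t := by rw [hpowc]; ring
      rw [e1, e2]; ring
    have hrow0 : ∀ v w : ℝ, HasDerivAt (fun x => v * x ^ a + w * x ^ c)
        (((a : ℝ) * v * t ^ a + (c : ℝ) * w * t ^ c) / t) t := by
      intro v w
      refine (((hasDerivAt_pow a t).const_mul v).fun_add ((hasDerivAt_pow c t).const_mul w)).congr_deriv ?_
      have e1 : v * ((a : ℝ) * t ^ (a - 1)) = (a : ℝ) * v * t ^ a / t := by rw [hpowa]; ring
      have e2 : w * ((c : ℝ) * t ^ (c - 1)) = (c : ℝ) * w * t ^ c / t := by rw [hpowc]; ring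
      rw [e1, e2]; ring
    have hPd : ∀ i, HasDerivAt (P i) (N i t / t) t := by
      intro i
      refine ((hrow (p i) (q i) (s i)).congr_of_eventuallyEq (Filter.Eventually.of_forall (hP i))).congr_deriv ?_
      rw [hN]
    have hNd : ∀ i, HasDerivAt (N i) (M i t / t) t := by
      intro i
      refine ((hrow0 ((a : ℝ) * q i) ((c : ℝ) * s i)).congr_of_eventuallyEq
        (Filter.Eventually.of_forall (hN i))).congr_deriv ?_
      rw [hM]; ring
    have hMd : ∀ i, HasDerivAt (M i) (L i t / t) t := by
      intro i
      refine ((hrow0 ((a : ℝ) ^ 2 * q i) ((c : ℝ) ^ 2 * s i)).congr_of_eventuallyEq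
        (Filter.Eventually.of_forall (hM i))).congr_deriv ?_
      rw [hL]; ring
    have hψd : ∀ i, HasDerivAt (ψ i) ((M i t / P i t - ψ i t ^ 2) / t) t := by
      intro i
      have h1 := (hNd i).fun_div (hPd i) (hPpos i t ht).ne'
      refine (h1.congr_of_eventuallyEq (Filter.Eventually.of_forall (hψ i))).congr_deriv ?_
      have hP0 : P i t ≠ 0 := (hPpos i t ht).ne'
      rw [hψ]
      field_simp
    have hWd : ∀ i, HasDerivAt (fun x => M i x / P i x - ψ i x ^ 2)
        ((L i t / P i t - M i t * N i t / P i t ^ 2 - 2 * (N i t / P i t) * (M i t / P i t - (N i t / P i t) ^ 2)) / t) t := by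
      intro i
      have h1 := ((hMd i).fun_div (hPd i) (hPpos i t ht).ne').fun_sub ((hψd i).fun_mul (hψd i))
      have e : (fun x => M i x / P i x - ψ i x ^ 2) = fun x => M i x / P i x - ψ i x * ψ i x :=
        funext fun x => by ring
      rw [e]
      refine h1.congr_deriv ?_
      have hP0 : P i t ≠ 0 := (hPpos i t ht).ne'
      rw [hψ]
      field_simp
      ring
    have hVd : HasDerivAt V (V₃ t / t) t := by
      have h1 := HasDerivAt.fun_sum (u := univ) (fun i _ => hWd i)
      refine (h1.congr_of_eventuallyEq (Filter.Eventually.of_forall hV)).congr_deriv ?_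
      rw [hV₃, sum_div]
    have hψBd : HasDerivAt ψB (V t / t) t := by
      have h1 : HasDerivAt (fun x => ∑ i, ψ i x) (∑ i, (M i t / P i t - ψ i t ^ 2) / t) t :=
        HasDerivAt.fun_sum (u := univ) (fun i _ => hψd i)
      refine (h1.congr_of_eventuallyEq (Filter.Eventually.of_forall hψB)).congr_deriv ?_
      rw [hV, sum_div]
    have hGd : HasDerivAt G (G₂ t / t) t := by
      refine ((hrow0 ((a : ℝ) * κ) ((c : ℝ) * γ)).congr_of_eventuallyEq
        (Filter.Eventually.of_forall hG)).congr_deriv ?_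
      rw [hG₂]; ring
    have hG₂d : HasDerivAt G₂ (G₃ t / t) t := by
      refine ((hrow0 ((a : ℝ) ^ 2 * κ) ((c : ℝ) ^ 2 * γ)).congr_of_eventuallyEq
        (Filter.Eventually.of_forall hG₂)).congr_deriv ?_
      rw [hG₃]; ring
    have h1 := ((hVd.fun_div hψBd (hψBpos t ht).ne').fun_sub hψBd).fun_sub (hG₂d.fun_div hGd (hGpos t ht).ne')
    refine (h1.congr_of_eventuallyEq (Filter.Eventually.of_forall hJ)).congr_deriv ?_
    have hB0 : ψB t ≠ 0 := (hψBpos t ht).ne'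
    have hG0 : G t ≠ 0 := (hGpos t ht).ne'
    rw [hJ']
    field_simp
  have hJid : ∀ t, 0 < t → J t = 0 →
      ψB t * (t * J' t) = (k : ℝ) * ((k : ℝ) + 1) * (N j₀ t / P j₀ t) ^ 2 *
        (((a : ℝ) + c - 3 * (G₂ t / G t)) - (2 * (k : ℝ) + 1) * (N j₀ t / P j₀ t)) := by
    intro t ht hJt
    have hψpos := hψBpos t ht
    have hG0 : G t ≠ 0 := (hGpos t ht).ne'
    obtain ⟨A, hA⟩ : ∃ A : ℝ, A = G₂ t / G t := ⟨_, rfl⟩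
    have hAa : (a : ℝ) < A := by rw [hA]; exact hAgt t ht
    -- rates and variances of the rows at `t`
    obtain ⟨e, he⟩ : ∃ e : Fin k → ℝ, ∀ i, e i = N i t / P i t := ⟨_, fun _ => rfl⟩
    obtain ⟨w, hw⟩ : ∃ w : Fin k → ℝ, ∀ i, w i = M i t / P i t - e i ^ 2 := ⟨_, fun _ => rfl⟩
    have heψ : ∀ i, ψ i t = e i := fun i => by rw [hψ, he]
    have hψe : ψB t = ∑ i, e i := by rw [hψB]; exact sum_congr rfl fun i _ => heψ i
    have hVw : V t = ∑ i, w i := by rw [hV]; exact sum_congr rfl fun i _ => by rw [hw, heψ]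
    have henn : ∀ i, 0 ≤ e i := fun i => by rw [← heψ]; exact hψnn i t ht
    have hwe : ∀ i, e i * ((a : ℝ) - e i) ≤ w i := by
      intro i
      have hP0 : 0 < P i t := hPpos i t ht
      have h1 : (a : ℝ) * e i ≤ M i t / P i t := by
        rw [he, ← mul_div_assoc, div_le_div_iff_of_pos_right hP0, hM, hN]
        have : (a : ℝ) * ((c : ℝ) * s i * t ^ c) ≤ (c : ℝ) ^ 2 * s i * t ^ c := by
          have h2 : 0 ≤ (c : ℝ) * s i * t ^ c := mul_nonneg (mul_nonneg hc'.le (h i).2.2) (pow_pos ht c).le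
          nlinarith
        nlinarith
      rw [hw]; nlinarith
    have hVeq : V t = ψB t * (ψB t + A) := by
      rw [hJ, ← hA] at hJt
      field_simp at hJt
      linarith
    -- the support identity `X(X−a)(X−c) = 0`: third moments from second ones
    have hLMN : ∀ i, L i t = ((a : ℝ) + c) * M i t - (a : ℝ) * c * N i t := fun i => by
      rw [hL, hM, hN]; ring
    have hV₃e : V₃ t = ((a : ℝ) + c) * (∑ i, w i) - 3 * (∑ i, w i * e i) + ((a : ℝ) + c) * (∑ i, e i ^ 2)
        - (a : ℝ) * c * (∑ i, e i) - ∑ i, e i ^ 3 := by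
      rw [hV₃, mul_sum, mul_sum, mul_sum, mul_sum, ← sum_sub_distrib, ← sum_add_distrib, ← sum_sub_distrib,
        ← sum_sub_distrib]
      refine sum_congr rfl fun i _ => ?_
      have hP0 : P i t ≠ 0 := (hPpos i t ht).ne'
      rw [hw, he, hLMN]
      field_simp
      ring
    have hVarA : (G₃ t * G t - G₂ t * G₂ t) / G t ^ 2 = (A - a) * ((c : ℝ) - A) := by
      rw [hA, div_eq_iff (pow_ne_zero 2 hG0)]
      field_simp
      rw [hG₃, hG₂, hG]
      ring
    have h1' : ∑ i, w i * (e i + ∑ j, e j) = ∑ i, w i * e i + (∑ j, e j) * ∑ i, w i := by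
      rw [Finset.mul_sum, ← Finset.sum_add_distrib]
      exact Finset.sum_congr rfl fun i _ => by ring
    have h2' : ∑ i, e i * (e i - a) * (e i - c)
        = ∑ i, e i ^ 3 - ((a : ℝ) + c) * ∑ i, e i ^ 2 + (a : ℝ) * c * ∑ i, e i := by
      rw [Finset.mul_sum, Finset.mul_sum, ← Finset.sum_sub_distrib, ← Finset.sum_add_distrib]
      exact Finset.sum_congr rfl fun i _ => by ring
    have htJ : t * J' t = (V₃ t * ψB t - V t * V t) / ψB t ^ 2 - V t - (G₃ t * G t - G₂ t * G₂ t) / G t ^ 2 := by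
      rw [hJ']; field_simp
    have hid : ψB t * (t * J' t) =
        -3 * (∑ i, w i * e i + (∑ j, e j) * ∑ i, w i)
          - (∑ i, e i ^ 3 - ((a : ℝ) + c) * ∑ i, e i ^ 2 + (a : ℝ) * c * ∑ i, e i)
          + (c + ∑ i, e i) * (∑ i, e i) * (a + ∑ i, e i) := by
      rw [htJ, hVarA, hV₃e, ← hVw, ← hψe, hVeq]
      field_simp
      ring
    -- identical rows: all rates/variances coincide
    have hee : ∀ i, e i = e j₀ := fun i => by rw [he, he, hN, hN, hP, hP]
    have hww : ∀ i, w i = w j₀ := fun i => by rw [hw, hw, hee, hM, hM, hP, hP]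
    have hk' : (Fintype.card (Fin k) : ℝ) = k := by simp
    have hSe : ∑ i, e i = (k : ℝ) * e j₀ := by
      rw [Finset.sum_congr rfl (fun i _ => hee i), Finset.sum_const, Finset.card_univ, nsmul_eq_mul, hk']
    have hSe2 : ∑ i, e i ^ 2 = (k : ℝ) * e j₀ ^ 2 := by
      rw [Finset.sum_congr rfl (fun i _ => by rw [hee i]), Finset.sum_const, Finset.card_univ, nsmul_eq_mul, hk']
    have hSe3 : ∑ i, e i ^ 3 = (k : ℝ) * e j₀ ^ 3 := by
      rw [Finset.sum_congr rfl (fun i _ => by rw [hee i]), Finset.sum_const, Finset.card_univ, nsmul_eq_mul, hk']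
    have hSw : ∑ i, w i = (k : ℝ) * w j₀ := by
      rw [Finset.sum_congr rfl (fun i _ => hww i), Finset.sum_const, Finset.card_univ, nsmul_eq_mul, hk']
    have hSwe : ∑ i, w i * e i = (k : ℝ) * (w j₀ * e j₀) := by
      rw [Finset.sum_congr rfl (fun i _ => by rw [hww i, hee i]), Finset.sum_const, Finset.card_univ, nsmul_eq_mul, hk']
    have hkpos : (0 : ℝ) < k := by exact_mod_cast hk
    have hw₀ : w j₀ = e j₀ * ((k : ℝ) * e j₀ + A) := by
      have h1 : (k : ℝ) * w j₀ = (k : ℝ) * e j₀ * ((k : ℝ) * e j₀ + A) := by rw [← hSw, ← hVw, hVeq, hψe, hSe]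
      have h2 : (k : ℝ) * (w j₀ - e j₀ * ((k : ℝ) * e j₀ + A)) = 0 := by linarith
      rcases mul_eq_zero.1 h2 with h3 | h3
      · exact absurd h3 hkpos.ne'
      · linarith
    rw [hid, hSwe, hSe, hSw, hSe2, hSe3, hw₀, ← he, hA]
    ring

  -- the threshold function `T` is strictly decreasing
  obtain ⟨T, hT⟩ : ∃ T : ℝ → ℝ, ∀ t, T t = ((a : ℝ) + c - 3 * (G₂ t / G t)) - (2 * (k : ℝ) + 1) * (N j₀ t / P j₀ t) :=
    ⟨_, fun _ => rfl⟩
  have hTanti : ∀ t t', 0 < t → t < t' → T t' < T t := by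
    intro t t' ht htt
    have h1 := rowRate_strictMono ha hac hp₀ hq₀ hs₀ ht htt
    have h2 := ratio_mono ha hac hκ hγ ht htt.le
    rw [hT, hT, hN, hN, hP, hP, hG₂, hG₂, hG, hG, hp j₀, hq j₀, hs j₀]
    have hk0 : (0 : ℝ) < 2 * (k : ℝ) + 1 := by positivity
    nlinarith [mul_lt_mul_of_pos_left h1 hk0]
  -- sign of `J′` at a zero of `J`
  have hepos : ∀ t, 0 < t → 0 < N j₀ t / P j₀ t := by
    intro t ht
    have hNi : 0 < N j₀ t := by
      rw [hN, hs j₀]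
      exact add_pos_of_nonneg_of_pos (mul_nonneg (mul_nonneg ha'.le (h j₀).2.1) (pow_pos ht a).le) (by positivity)
    exact div_pos hNi (hPpos j₀ t ht)
  have hkpos : (0 : ℝ) < k := by exact_mod_cast hk
  have hJ'pos : ∀ t, 0 < t → J t = 0 → 0 < T t → 0 < J' t := by
    intro t ht hJt hTt
    have hid := hJid t ht hJt
    rw [← hT] at hid
    have hpos : 0 < (k : ℝ) * ((k : ℝ) + 1) * (N j₀ t / P j₀ t) ^ 2 * T t := by
      have := hepos t ht; positivity
    by_contra hle
    push Not at hle
    have : ψB t * (t * J' t) ≤ 0 := mul_nonpos_of_nonneg_of_nonpos (hψBpos t ht).le (mul_nonpos_of_nonneg_of_nonpos ht.le hle)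
    linarith
  have hJ'neg : ∀ t, 0 < t → J t = 0 → T t < 0 → J' t < 0 := by
    intro t ht hJt hTt
    have hid := hJid t ht hJt
    rw [← hT] at hid
    have hneg : (k : ℝ) * ((k : ℝ) + 1) * (N j₀ t / P j₀ t) ^ 2 * T t < 0 := by
      have := hepos t ht
      exact mul_neg_of_pos_of_neg (by positivity) hTt
    by_contra hle
    push Not at hle
    have : 0 ≤ ψB t * (t * J' t) := mul_nonneg (hψBpos t ht).le (mul_nonneg ht.le hle)
    linarith
  -- zeros of `J` between consecutive critical points (engine), in `J`-form
  have hRolle : ∀ u v, 0 < u → u < v →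
      (derivative (row a c (-α) κ γ * ∏ i, row a c (p i) (q i) (s i))).eval u = 0 →
      (derivative (row a c (-α) κ γ * ∏ i, row a c (p i) (q i) (s i))).eval v = 0 → ∃ ξ, u < ξ ∧ ξ < v ∧ J ξ = 0 := by
    intro u v hu huv hDu hDv
    obtain ⟨ξ, h1, h2, h3⟩ := exists_rateJ_zero_between_crit k a c ha hac α κ γ p q s hκ hγ h' hu huv hDu hDv
    exact ⟨ξ, h1, h2, by rw [hJfun]; exact h3⟩
  exact ⟨J, J', T, hJd, hTanti, hJ'pos, hJ'neg, hRolle, hJfun⟩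

end ZeroChange

end Summit.ValiantsHypothesis.ValiantsHypothesis.Theorems.LacunarySymmetroidMatrixDescartes
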